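import Mathlib
import Summits.ValiantsHypothesis.ValiantsHypothesis.Theorems.NewtonUnitEquationsDissociatedUniformTotalsLawHeavyPairs
import HarnessLib

/-!
# Crux `NewtonUnitEquations.DissociatedUniform` (stmt-ValiantsHypothesis-5905), `n = 3` totals law of model (Q**):
# TRIANGLE WORDS of three interval systems are `O(|G|^{5/2})`

Second combinatorial layer of the sub-cubic bound (companion of `…TotalsLawHeavyPairs`).  Three top systems over the label
group `G` (time `i ≤ N` → fibre → top letter): `TP i r = x` says the pair `(x, r - x)` tops the `P`-fibre `r`, `TQ i t = y` says
`(y, t - y)` tops the `Q`-fibre `t`, `TR i u = x` says `(x, u - x)` tops the `R`-fibre `u`.  A word `(x, y, z)` is a TRIANGLE at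
time `i` (`IsTri`) if `TP i (x+y) = x`, `TQ i (y+z) = y`, `TR i (x+z) = x` — its three pair projections top their fibres
simultaneously (the located relaxation `T ≤ N_△` of NOTES-d1g3 §2 L6, here in tie-broken letter form).

* `birth N T f ℓ` — the first time `≤ N` at which `ℓ` tops `f`; for interval systems a letter tops its fibre on `[birth, i]`
  whenever it does at `i` (`eq_of_birth_le`).
* `isTri_maxBirth` — a word that is ever a triangle is a triangle at the LATEST of its three births (intersection of three
  intervals), i.e. at the birth of one of its own pairs: `triWords ⊆ W_P ∪ W_Q ∪ W_R`.
* `card_bornP_le` / `card_bornQ_le` / `card_bornR_le` — the words that are triangles at the birth of their `P`-pair `(x, y)`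
  number at most `∑_{(x,y)} min (deg_Q y) (deg_R x)` (degrees at the birth time: the third letter `z` must top a `Q`-fibre with
  `y` and an `R`-fibre with `x`), which `…HeavyPairs.sum_min_topDeg_le` bounds by `2K|G|² + 16|G|³/K`; the `Q`- and `R`-births
  are the same statement for the complementary views `coTop T i f = f - T i f` (second letter of the top pair).
* `card_triWords_le` — `#triWords ≤ 3 (2K|G|² + 16|G|³/K)` for every `K ≥ 1`.
The geometric instantiation (chart samples, tie-broken tops) and the assembly `T(a,b,c) = O(|G|^{5/2})` are the companions
`…TotalsLawChartSamples`, `…TotalsLawSubCubic`.  Nothing here bears on VP ≠ VNP.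
[folklore]
-/

set_option linter.dupNamespace false -- `ValiantsHypothesis.ValiantsHypothesis` (summit = problem) in every name

open Finset

namespace Summit.ValiantsHypothesis.ValiantsHypothesis.Theorems.NewtonUnitEquationsDissociatedUniform

namespace TotalsLaw

variable {G : Type*} [AddCommGroup G] [Fintype G] [DecidableEq G]

/-! ### Births -/

open Classical in
/-- The first time `≤ N` at which the letter `ℓ` tops the fibre `f` (junk value `0` if it never does). -/
noncomputable def birth (N : ℕ) (T : ℕ → G → G) (f ℓ : G) : ℕ :=
  if h : ∃ i, i ≤ N ∧ T i f = ℓ then Nat.find h else 0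

omit [AddCommGroup G] [Fintype G] in
/-- `birth ≤ N`. [folklore] -/
theorem birth_le (N : ℕ) (T : ℕ → G → G) (f ℓ : G) : birth N T f ℓ ≤ N := by
  classical
  unfold birth
  split_ifs with h
  · exact (Nat.find_spec h).1
  · exact Nat.zero_le _

omit [AddCommGroup G] [Fintype G] in
/-- The birth is at most any time at which the letter tops the fibre. [folklore] -/
theorem birth_le_of_eq {N : ℕ} {T : ℕ → G → G} {f ℓ : G} {i : ℕ} (hi : i ≤ N) (h : T i f = ℓ) :
    birth N T f ℓ ≤ i := by
  classical
  unfold birth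
  rw [dif_pos ⟨i, hi, h⟩]
  exact Nat.find_min' _ ⟨hi, h⟩

omit [AddCommGroup G] [Fintype G] in
/-- At its birth the letter tops the fibre (if it ever does). [folklore] -/
theorem eq_at_birth {N : ℕ} {T : ℕ → G → G} {f ℓ : G} {i : ℕ} (hi : i ≤ N) (h : T i f = ℓ) :
    T (birth N T f ℓ) f = ℓ := by
  classical
  unfold birth
  rw [dif_pos ⟨i, hi, h⟩]
  exact (Nat.find_spec (⟨i, hi, h⟩ : ∃ i, i ≤ N ∧ T i f = ℓ)).2

omit [AddCommGroup G] [Fintype G] in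
/-- **Intervals.**  In an interval system a letter topping `f` at time `i ≤ N` tops it at every time between its birth and `i`.
[folklore] -/
theorem eq_of_birth_le {N : ℕ} {T : ℕ → G → G} (hT : IsIntervalSys N T) {f ℓ : G} {i j : ℕ} (hi : i ≤ N) (h : T i f = ℓ)
    (hbj : birth N T f ℓ ≤ j) (hji : j ≤ i) : T j f = ℓ :=
  hT f ℓ (birth N T f ℓ) j i hbj hji hi (eq_at_birth hi h) h

/-! ### Triangle words -/

/-- `(x, y, z)` is a TRIANGLE at time `i`: `x` tops the `P`-fibre `x + y`, `y` tops the `Q`-fibre `y + z`, `x` tops the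
`R`-fibre `x + z`. -/
def IsTri (TP TQ TR : ℕ → G → G) (i : ℕ) (w : G × G × G) : Prop :=
  TP i (w.1 + w.2.1) = w.1 ∧ TQ i (w.2.1 + w.2.2) = w.2.1 ∧ TR i (w.1 + w.2.2) = w.1

open Classical in
/-- The words that are triangles at some time `≤ N`. -/
noncomputable def triWords (N : ℕ) (TP TQ TR : ℕ → G → G) : Finset (G × G × G) :=
  univ.filter fun w => ∃ i ≤ N, IsTri TP TQ TR i w

/-- The complementary view of a top system: the SECOND letter `f - T i f` of the top pair of the fibre `f`. -/
def coTop (T : ℕ → G → G) : ℕ → G → G := fun i f => f - T i f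

omit [Fintype G] [DecidableEq G] in
/-- The complementary view of an interval system is an interval system. [folklore] -/
theorem isIntervalSys_coTop {N : ℕ} {T : ℕ → G → G} (hT : IsIntervalSys N T) : IsIntervalSys N (coTop T) := by
  intro f ℓ i j k hij hjk hk hi hk'
  simp only [coTop] at hi hk' ⊢
  have h1 : T i f = f - ℓ := by rw [← hi]; abel
  have h2 : T k f = f - ℓ := by rw [← hk']; abel
  rw [hT f (f - ℓ) i j k hij hjk hk h1 h2]; abel

/-- The latest of the three births of a word. -/
noncomputable def maxBirth (N : ℕ) (TP TQ TR : ℕ → G → G) (w : G × G × G) : ℕ :=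
  max (birth N TP (w.1 + w.2.1) w.1) (max (birth N TQ (w.2.1 + w.2.2) w.2.1) (birth N TR (w.1 + w.2.2) w.1))

omit [Fintype G] in
/-- **A triangle is a triangle at the latest of its three births.** [folklore] -/
theorem isTri_maxBirth {N : ℕ} {TP TQ TR : ℕ → G → G} (hP : IsIntervalSys N TP) (hQ : IsIntervalSys N TQ)
    (hR : IsIntervalSys N TR) {w : G × G × G} {i : ℕ} (hi : i ≤ N) (h : IsTri TP TQ TR i w) :
    IsTri TP TQ TR (maxBirth N TP TQ TR w) w := by
  obtain ⟨h1, h2, h3⟩ := h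
  have b1 := birth_le_of_eq hi h1
  have b2 := birth_le_of_eq hi h2
  have b3 := birth_le_of_eq hi h3
  have hβ : maxBirth N TP TQ TR w ≤ i := max_le b1 (max_le b2 b3)
  refine ⟨eq_of_birth_le hP hi h1 (le_max_left _ _) hβ, eq_of_birth_le hQ hi h2 ?_ hβ, eq_of_birth_le hR hi h3 ?_ hβ⟩
  · exact le_trans (le_max_left _ _) (le_max_right _ _)
  · exact le_trans (le_max_right _ _) (le_max_right _ _)

open Classical in
/-- **`triWords ⊆ W_P ∪ W_Q ∪ W_R`**: every triangle word is a triangle at the birth of one of its own pairs. [folklore] -/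
theorem triWords_subset {N : ℕ} {TP TQ TR : ℕ → G → G} (hP : IsIntervalSys N TP) (hQ : IsIntervalSys N TQ)
    (hR : IsIntervalSys N TR) :
    triWords N TP TQ TR ⊆
      (univ.filter fun w : G × G × G => IsTri TP TQ TR (birth N TP (w.1 + w.2.1) w.1) w) ∪
      (univ.filter fun w : G × G × G => IsTri TP TQ TR (birth N TQ (w.2.1 + w.2.2) w.2.1) w) ∪
      (univ.filter fun w : G × G × G => IsTri TP TQ TR (birth N TR (w.1 + w.2.2) w.1) w) := by
  intro w hw
  obtain ⟨-, i, hi, htri⟩ := mem_filter.1 hw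
  have key := isTri_maxBirth hP hQ hR hi htri
  rw [mem_union, mem_union, mem_filter, mem_filter, mem_filter]
  unfold maxBirth at key
  rcases max_choice (birth N TP (w.1 + w.2.1) w.1)
      (max (birth N TQ (w.2.1 + w.2.2) w.2.1) (birth N TR (w.1 + w.2.2) w.1)) with h | h
  · exact Or.inl (Or.inl ⟨mem_univ _, by rwa [h] at key⟩)
  · rw [h] at key
    rcases max_choice (birth N TQ (w.2.1 + w.2.2) w.2.1) (birth N TR (w.1 + w.2.2) w.1) with h' | h'
    · exact Or.inl (Or.inr ⟨mem_univ _, by rwa [h'] at key⟩)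
    · exact Or.inr ⟨mem_univ _, by rwa [h'] at key⟩

/-! ### Counting fibres through a letter -/

/-- `#{z : T i (g + z) = ℓ} = topDeg T i ℓ` (translate the fibre index). [folklore] -/
theorem card_filter_add_eq_topDeg (T : ℕ → G → G) (i : ℕ) (g ℓ : G) :
    (univ.filter fun z : G => T i (g + z) = ℓ).card = topDeg T i ℓ := by
  unfold topDeg
  refine card_bij (fun z _ => g + z) (fun z hz => ?_) (fun z₁ _ z₂ _ h => add_left_cancel h) (fun f hf => ?_)
  · exact mem_filter.2 ⟨mem_univ _, (mem_filter.1 hz).2⟩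
  · exact ⟨-g + f, mem_filter.2 ⟨mem_univ _, by rw [add_neg_cancel_left]; exact (mem_filter.1 hf).2⟩, add_neg_cancel_left g f⟩

/-- `#{x : T i (x + g) = x} = topDeg (coTop T) i g` (the fibres whose top pair has second letter `g`). [folklore] -/
theorem card_filter_eq_self_eq_topDeg (T : ℕ → G → G) (i : ℕ) (g : G) :
    (univ.filter fun x : G => T i (x + g) = x).card = topDeg (coTop T) i g := by
  unfold topDeg
  refine card_bij (fun x _ => x + g) (fun x hx => ?_) (fun x₁ _ x₂ _ h => add_right_cancel h) (fun f hf => ?_)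
  · have := (mem_filter.1 hx).2
    exact mem_filter.2 ⟨mem_univ _, by simp only [coTop]; rw [this]; abel⟩
  · have : f - T i f = g := (mem_filter.1 hf).2
    refine ⟨f - g, mem_filter.2 ⟨mem_univ _, ?_⟩, by rw [sub_add_cancel]⟩
    rw [sub_add_cancel, ← this]; abel

/-! ### Words born as triangles through a given pair -/

open Classical in
/-- **`P`-births.**  The words that are triangles at the birth of their `P`-pair number at most `2K|G|² + 16|G|³/K`. [folklore] -/
theorem card_bornP_le {N : ℕ} {TP TQ TR : ℕ → G → G} (hQ : IsIntervalSys N TQ) (hR : IsIntervalSys N TR) {K : ℕ}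
    (hK : 1 ≤ K) :
    (univ.filter fun w : G × G × G => IsTri TP TQ TR (birth N TP (w.1 + w.2.1) w.1) w).card ≤
      2 * K * Fintype.card G ^ 2 + 16 * Fintype.card G ^ 3 / K := by
  set W := univ.filter fun w : G × G × G => IsTri TP TQ TR (birth N TP (w.1 + w.2.1) w.1) w with hW
  set b : G × G → ℕ := fun p => birth N TP (p.1 + p.2) p.1 with hb
  have hfib : ∀ p : G × G, (W.filter fun w => (w.1, w.2.1) = p).card ≤ min (topDeg TQ (b p) p.2) (topDeg TR (b p) p.1) := by
    rintro ⟨x, y⟩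
    have hinj : Set.InjOn (fun w : G × G × G => w.2.2) ↑(W.filter fun w => (w.1, w.2.1) = (x, y)) := by
      rintro ⟨x₁, y₁, z₁⟩ h₁ ⟨x₂, y₂, z₂⟩ h₂ (hz : z₁ = z₂)
      have e₁ := (mem_filter.1 (mem_coe.1 h₁)).2
      have e₂ := (mem_filter.1 (mem_coe.1 h₂)).2
      simp only [Prod.mk.injEq] at e₁ e₂
      rw [e₁.1, e₁.2, e₂.1, e₂.2, hz]
    refine le_min ?_ ?_
    · rw [← card_filter_add_eq_topDeg TQ (b (x, y)) y y]
      refine card_le_card_of_injOn (fun w => w.2.2) (fun w hw => ?_) hinj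
      obtain ⟨hwW, hp⟩ := mem_filter.1 hw
      obtain ⟨-, htri⟩ := mem_filter.1 hwW
      simp only [Prod.mk.injEq] at hp
      obtain ⟨-, h2, -⟩ := htri
      rw [hp.1, hp.2] at h2
      exact mem_coe.2 (mem_filter.2 ⟨mem_univ _, h2⟩)
    · rw [← card_filter_add_eq_topDeg TR (b (x, y)) x x]
      refine card_le_card_of_injOn (fun w => w.2.2) (fun w hw => ?_) hinj
      obtain ⟨hwW, hp⟩ := mem_filter.1 hw
      obtain ⟨-, htri⟩ := mem_filter.1 hwW
      simp only [Prod.mk.injEq] at hp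
      obtain ⟨-, -, h3⟩ := htri
      rw [hp.1, hp.2] at h3
      exact mem_coe.2 (mem_filter.2 ⟨mem_univ _, h3⟩)
  calc W.card = ∑ p : G × G, (W.filter fun w => (w.1, w.2.1) = p).card :=
        card_eq_sum_card_fiberwise fun w _ => mem_univ (w.1, w.2.1)
    _ ≤ ∑ p : G × G, min (topDeg TQ (b p) p.2) (topDeg TR (b p) p.1) := sum_le_sum fun p _ => hfib p
    _ ≤ 2 * K * Fintype.card G ^ 2 + 16 * Fintype.card G ^ 3 / K :=
        sum_min_topDeg_le hQ hR b (fun p => birth_le _ _ _ _) hK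

open Classical in
/-- **`Q`-births.**  The words that are triangles at the birth of their `Q`-pair number at most `2K|G|² + 16|G|³/K`. [folklore] -/
theorem card_bornQ_le {N : ℕ} {TP TQ TR : ℕ → G → G} (hP : IsIntervalSys N TP) (hR : IsIntervalSys N TR) {K : ℕ}
    (hK : 1 ≤ K) :
    (univ.filter fun w : G × G × G => IsTri TP TQ TR (birth N TQ (w.2.1 + w.2.2) w.2.1) w).card ≤
      2 * K * Fintype.card G ^ 2 + 16 * Fintype.card G ^ 3 / K := by
  set W := univ.filter fun w : G × G × G => IsTri TP TQ TR (birth N TQ (w.2.1 + w.2.2) w.2.1) w with hW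
  set b : G × G → ℕ := fun p => birth N TQ (p.1 + p.2) p.1 with hb
  have hfib : ∀ p : G × G, (W.filter fun w => (w.2.1, w.2.2) = p).card ≤
      min (topDeg (coTop TR) (b p) p.2) (topDeg (coTop TP) (b p) p.1) := by
    rintro ⟨y, z⟩
    have hinj : Set.InjOn (fun w : G × G × G => w.1) ↑(W.filter fun w => (w.2.1, w.2.2) = (y, z)) := by
      rintro ⟨x₁, y₁, z₁⟩ h₁ ⟨x₂, y₂, z₂⟩ h₂ (hx : x₁ = x₂)
      have e₁ := (mem_filter.1 (mem_coe.1 h₁)).2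
      have e₂ := (mem_filter.1 (mem_coe.1 h₂)).2
      simp only [Prod.mk.injEq] at e₁ e₂
      rw [e₁.1, e₁.2, e₂.1, e₂.2, hx]
    refine le_min ?_ ?_
    · rw [← card_filter_eq_self_eq_topDeg TR (b (y, z)) z]
      refine card_le_card_of_injOn (fun w => w.1) (fun w hw => ?_) hinj
      obtain ⟨hwW, hp⟩ := mem_filter.1 hw
      obtain ⟨-, htri⟩ := mem_filter.1 hwW
      simp only [Prod.mk.injEq] at hp
      obtain ⟨-, -, h3⟩ := htri
      rw [hp.1, hp.2] at h3
      exact mem_coe.2 (mem_filter.2 ⟨mem_univ _, h3⟩)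
    · rw [← card_filter_eq_self_eq_topDeg TP (b (y, z)) y]
      refine card_le_card_of_injOn (fun w => w.1) (fun w hw => ?_) hinj
      obtain ⟨hwW, hp⟩ := mem_filter.1 hw
      obtain ⟨-, htri⟩ := mem_filter.1 hwW
      simp only [Prod.mk.injEq] at hp
      obtain ⟨h1, -, -⟩ := htri
      rw [hp.1, hp.2] at h1
      exact mem_coe.2 (mem_filter.2 ⟨mem_univ _, h1⟩)
  calc W.card = ∑ p : G × G, (W.filter fun w => (w.2.1, w.2.2) = p).card :=
        card_eq_sum_card_fiberwise fun w _ => mem_univ (w.2.1, w.2.2)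
    _ ≤ ∑ p : G × G, min (topDeg (coTop TR) (b p) p.2) (topDeg (coTop TP) (b p) p.1) := sum_le_sum fun p _ => hfib p
    _ ≤ 2 * K * Fintype.card G ^ 2 + 16 * Fintype.card G ^ 3 / K :=
        sum_min_topDeg_le (isIntervalSys_coTop hR) (isIntervalSys_coTop hP) b (fun p => birth_le _ _ _ _) hK

open Classical in
/-- **`R`-births.**  The words that are triangles at the birth of their `R`-pair number at most `2K|G|² + 16|G|³/K`. [folklore] -/
theorem card_bornR_le {N : ℕ} {TP TQ TR : ℕ → G → G} (hP : IsIntervalSys N TP) (hQ : IsIntervalSys N TQ) {K : ℕ}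
    (hK : 1 ≤ K) :
    (univ.filter fun w : G × G × G => IsTri TP TQ TR (birth N TR (w.1 + w.2.2) w.1) w).card ≤
      2 * K * Fintype.card G ^ 2 + 16 * Fintype.card G ^ 3 / K := by
  set W := univ.filter fun w : G × G × G => IsTri TP TQ TR (birth N TR (w.1 + w.2.2) w.1) w with hW
  set b : G × G → ℕ := fun p => birth N TR (p.1 + p.2) p.1 with hb
  have hfib : ∀ p : G × G, (W.filter fun w => (w.1, w.2.2) = p).card ≤
      min (topDeg (coTop TQ) (b p) p.2) (topDeg TP (b p) p.1) := by
    rintro ⟨x, z⟩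
    have hinj : Set.InjOn (fun w : G × G × G => w.2.1) ↑(W.filter fun w => (w.1, w.2.2) = (x, z)) := by
      rintro ⟨x₁, y₁, z₁⟩ h₁ ⟨x₂, y₂, z₂⟩ h₂ (hy : y₁ = y₂)
      have e₁ := (mem_filter.1 (mem_coe.1 h₁)).2
      have e₂ := (mem_filter.1 (mem_coe.1 h₂)).2
      simp only [Prod.mk.injEq] at e₁ e₂
      rw [e₁.1, e₁.2, e₂.1, e₂.2, hy]
    refine le_min ?_ ?_
    · rw [← card_filter_eq_self_eq_topDeg TQ (b (x, z)) z]
      refine card_le_card_of_injOn (fun w => w.2.1) (fun w hw => ?_) hinj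
      obtain ⟨hwW, hp⟩ := mem_filter.1 hw
      obtain ⟨-, htri⟩ := mem_filter.1 hwW
      simp only [Prod.mk.injEq] at hp
      obtain ⟨-, h2, -⟩ := htri
      rw [hp.1, hp.2] at h2
      exact mem_coe.2 (mem_filter.2 ⟨mem_univ _, h2⟩)
    · rw [← card_filter_add_eq_topDeg TP (b (x, z)) x x]
      refine card_le_card_of_injOn (fun w => w.2.1) (fun w hw => ?_) hinj
      obtain ⟨hwW, hp⟩ := mem_filter.1 hw
      obtain ⟨-, htri⟩ := mem_filter.1 hwW
      simp only [Prod.mk.injEq] at hp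
      obtain ⟨h1, -, -⟩ := htri
      rw [hp.1, hp.2] at h1
      exact mem_coe.2 (mem_filter.2 ⟨mem_univ _, h1⟩)
  calc W.card = ∑ p : G × G, (W.filter fun w => (w.1, w.2.2) = p).card :=
        card_eq_sum_card_fiberwise fun w _ => mem_univ (w.1, w.2.2)
    _ ≤ ∑ p : G × G, min (topDeg (coTop TQ) (b p) p.2) (topDeg TP (b p) p.1) := sum_le_sum fun p _ => hfib p
    _ ≤ 2 * K * Fintype.card G ^ 2 + 16 * Fintype.card G ^ 3 / K :=
        sum_min_topDeg_le (isIntervalSys_coTop hQ) hP b (fun p => birth_le _ _ _ _) hK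

/-- **Triangle words are `O(|G|^{5/2})`.**  For three interval systems and every `K ≥ 1`,
`#triWords ≤ 3 (2K|G|² + 16|G|³/K)` (take `K ≈ √|G|`). [folklore] -/
theorem card_triWords_le {N : ℕ} {TP TQ TR : ℕ → G → G} (hP : IsIntervalSys N TP) (hQ : IsIntervalSys N TQ)
    (hR : IsIntervalSys N TR) {K : ℕ} (hK : 1 ≤ K) :
    (triWords N TP TQ TR).card ≤ 3 * (2 * K * Fintype.card G ^ 2 + 16 * Fintype.card G ^ 3 / K) := by
  classical
  calc (triWords N TP TQ TR).card ≤ _ := card_le_card (triWords_subset hP hQ hR)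
    _ ≤ _ := card_union_le _ _
    _ ≤ _ + _ := Nat.add_le_add_right (card_union_le _ _) _
    _ ≤ (2 * K * Fintype.card G ^ 2 + 16 * Fintype.card G ^ 3 / K) + (2 * K * Fintype.card G ^ 2 + 16 * Fintype.card G ^ 3 / K)
        + (2 * K * Fintype.card G ^ 2 + 16 * Fintype.card G ^ 3 / K) := by
        gcongr
        · exact card_bornP_le hQ hR hK
        · exact card_bornQ_le hP hR hK
        · exact card_bornR_le hP hQ hK
    _ = 3 * (2 * K * Fintype.card G ^ 2 + 16 * Fintype.card G ^ 3 / K) := by ring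

end TotalsLaw

end Summit.ValiantsHypothesis.ValiantsHypothesis.Theorems.NewtonUnitEquationsDissociatedUniform
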